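import Summits.BirchSwinnertonDyer.BirchSwinnertonDyer.Theses.GenusKolyvaginAtTwo
import Summits.BirchSwinnertonDyer.BirchSwinnertonDyer.Theorems.GenusKolyvaginAtTwoEquivariantChebotarevAtTwoOffDiscField
import HarnessLib

/-!
# Route `GenusKolyvaginAtTwo`, LINE 6 of crux 22137: Q5R `EquivariantChebotarevAtTwoR`
# (stmt-BirchSwinnertonDyer-27280) — CLOSED BY NAME (seat gk2-p3 g11)

Route rev 13 repaired the refuted child Q5 `EquivariantChebotarevAtTwo` (stmt-24881; refuted as typed by
`GenusExact.not_EquivariantChebotarevAtTwo`, witness `433a1 / ℚ(√−433)`, the discriminant field) into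
Q5R = Q5 VERBATIM plus Kolyvagin's exclusion `K ≠ ℚ(√Δ_E)`, typed as the parent crux's binder
`¬ IsSquare ((NumberField.discr K : ℚ) * -|W.Δ|)` inserted after `IsImaginaryQuadratic K`.

Q5R is, symbol for symbol, the type of the landed theorem
`GenusExact.equivariantChebotarevAtTwo_of_not_isSquare`
(`Theorems/GenusKolyvaginAtTwoEquivariantChebotarevAtTwoOffDiscField.lean`, seat gk2-p2 g6, p606279):
McCallum 1991 Cor. 3.2 at `p = 2` on `Δ(E) < 0` for `τ`-stable independent families with prescribed
local orders — Čebotarev in `K(E[2^M])/ℚ` applied to the class `τ·h` built from the free generator of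
`E[2^M]` over `ℤ/2^M[c₀]` (Q1, `CyclicTorsionOfNegDisc`) and the `GL₂(𝔽₂)`-image of `Γ_K` on `E[2]`
(simple, scalar commutant — exactly where the binder `K ≠ ℚ(√Δ_E)` is used).

This file only re-states that theorem at the route decl. HONEST FRAMING: closing Q5R does not close the
parent crux `KolyvaginExactAtTwo` (22137): the split glue `KolyvaginExactAtTwoOfSplit` (24884) and the key
child Q3 `EquivariantKolyvaginExactAtTwo` (24882) still name the retired Q5 and must be re-typed with Q5R by
the pen. BSD is not proved by any of this.

References: [McCallumLMS1991] §3 Cor. 3.2; [GrossLMS1991] §9; [Kolyvagin1989] Thm. B (the exclusions).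
-/

set_option autoImplicit false
set_option linter.dupNamespace false

namespace Summit.BirchSwinnertonDyer.BirchSwinnertonDyer.Theorems.GenusExact

/-- **Q5R `EquivariantChebotarevAtTwoR` (stmt-BirchSwinnertonDyer-27280) holds**: McCallum 1991 Cor. 3.2 at
`p = 2` on `Δ(E) < 0`, for every imaginary quadratic `K` with `d_K · (−|Δ_E|) ∉ ℚ^{×2}` and `ρ_{E,2^∞}`
onto — for every `τ`-stable `ℤ/2^M`-independent family `(c_i)` in `H¹(K, E[2^M])` meeting the inflation
kernel trivially and every prescription `N_i ≤ M_i` constant on `τ`-orbits, infinitely many Kolyvagin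
primes `ℓ` at `2` (Zhang's form, `M ≤ M(ℓ)`, `Frob_ℓ = Frob_∞` on `K(E[2^M])`) at whose place every `c_i`
has local order exactly `2^{N_i}`. One-line re-statement of
`GenusExact.equivariantChebotarevAtTwo_of_not_isSquare` (p606279) at the route decl.
[cite: McCallumLMS1991, §3 Cor. 3.2] [cite: GrossLMS1991, §9] -/
theorem equivariantChebotarevAtTwoR_proof :
    Summit.BirchSwinnertonDyer.BirchSwinnertonDyer.Theses.GenusKolyvaginAtTwo.EquivariantChebotarevAtTwoR := by
  unfold Summit.BirchSwinnertonDyer.BirchSwinnertonDyer.Theses.GenusKolyvaginAtTwo.EquivariantChebotarevAtTwoR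
  intro N _ W _ _ hcm hΔ K _ _ hK hns hρ c hc M hM r cs π h0 hτs hind hres Mi hMi Nv hNe hNπ
  exact equivariantChebotarevAtTwo_of_not_isSquare N W hcm hΔ K hK hns hρ c hc M hM r cs π h0 hτs hind
    hres Mi hMi Nv hNe hNπ

end Summit.BirchSwinnertonDyer.BirchSwinnertonDyer.Theorems.GenusExact
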